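/-
Origin: expansion seat `prover-pub-hodgecm-mc-binder-1-g10-0`, handover #35 2026-08-20T06:26:22Z md5 6d906b3afb72 (NEW additive KERNEL leaf: guarded twins of the four composite S read-backs; imports installed sinst-1 rows only; drop alone) (`HOME/mc/pub-hodgecm-mc-binder-1-g10/stage43/HodgeCM/Model/ThetaAdelicSideGuardedPOps.lean`, md5 6d906b3afb72, 118 lines);
landed by the gen-16 packager (p-g16) in gate run 43 as `HodgeCM/Model/ThetaAdelicSideGuardedPOps.lean` (verbatim).
-/
/-
Origin: speedrun cell pub-hodgecm, MODEL-CONSTRUCTION sub-cell, unit pub-hodgecm-mc-binder-1-g10 (BINDER PROVER, gen 10; S re-pin, P-twins of the four composite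
read-backs), seat prover-pub-hodgecm-mc-binder-1-g10-0, 2026-08-20.  Target in PKG: HodgeCM/Model/ThetaAdelicSideGuardedPOps.lean (NEW additive leaf; imports the
installed `Model/ThetaAdelicSideGuardedP` + `Model/ThetaAdelicSideInstance` only).  KERNEL ONLY: 4 theorems, each `rw [thetaAdelicSideOfP_eq_archSideOf … hc]; exact <period-1's
archSideOf statement>` — the guarded twins of `ThetaAdelicSideInstance`'s `regimeEquiv_prodSymm_one_mem_thetaAdelicSideOf_Gfin` / `op_` / `seesaw34_` / `op34_thetaAdelicSideOf`
(`hdef ↦ hG hc`).  0 records, nothing cited, 0 `def … : Prop`, MODEL-N ±0, E unchanged.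
-/
import Summits.HodgeConjecture.HodgeCM.Model.ThetaAdelicSideGuardedP
import Summits.HodgeConjecture.HodgeCM.Model.ThetaAdelicSideInstance

/-!
# The four composite read-backs of the PREDICATE-GUARDED S term (K34-PLAN §3, Q2)

binder-1's total layer (#26/#27, #28 r2–#31 r2) consumes, besides the field read-backs `thetaAdelicSideOf_{eq_archSideOf, P_ΓU, P_ω, ιinf,
Gfin, P_Φinf, P_x₀, P_w, ιinf_apply}` (whose guarded twins `thetaAdelicSideOfP_…` are installed), four COMPOSITE facts of the total term under
the sign condition; these are their twins for `thetaAdelicSideOfP V c G hG … AG` under the guard `hc : G` — so re-typing the layer at sinst-1's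
`SGP @G @hG … @AG` (and instantiating at `SROG`) is a rename.
-/

set_option autoImplicit false

noncomputable section

open scoped Matrix SchwartzMap
open NumberField NumberField.mixedEmbedding
open Literature.NumberTheory.Automorphic Literature.NumberTheory.Weil1964
open Literature.NumberTheory.GelbartRogawski1991.UnitaryDualPair
open HodgeCM.Adelic HodgeCM.PerL34
open Literature.Geometry.ComplexHyperbolic.BallModel (U21)
open Literature.AlgebraicGeometry.HodgeTheory
open Literature.NumberTheory.Automorphic.PicardCM
open scoped Matrix SchwartzMap
open NumberField NumberField.mixedEmbedding
open Literature.NumberTheory.Automorphic Literature.NumberTheory.Weil1964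
open Literature.NumberTheory.GelbartRogawski1991.UnitaryDualPair
open HodgeCM.Adelic HodgeCM.PerL34
open Literature.Geometry.ComplexHyperbolic.BallModel (U21)
open Literature.AlgebraicGeometry.HodgeTheory
open Literature.NumberTheory.Automorphic.PicardCM

namespace HodgeCM.Model

namespace ArchSideTerm

section GuardedPOps

variable {L : CMField} {ι₁ : L →+* ℂ} (V : HermSpace3 L ι₁) (c : SeesawCtx L) (G : Prop)
  (hG : G → (∀ j, 0 < (ι₁ (dW c.D j)).re) ∨ ∀ j, (ι₁ (dW c.D j)).re < 0)
  (hGR : (cmSplittingDatum (L : Type) finProdFinEquiv (frameD V) (frameD_real V) (frameD_ne V) (dW c.D) (dW_real c.D)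
    (dW_ne c.D)).CompatibleSplitting)
  (hGR₀ : (cmSplittingDatum (L : Type) (e₁) (frameD V) (frameD_real V) (frameD_ne V) (lineVec (L : Type) (dW c.D 0))
    (fun _ => dW_real c.D 0) (fun _ => dW_ne c.D 0)).CompatibleSplitting)
  (hGR₁ : (cmSplittingDatum (L : Type) (e₁) (frameD V) (frameD_real V) (frameD_ne V) (lineVec (L : Type) (dW c.D 1))
    (fun _ => dW_real c.D 1) (fun _ => dW_ne c.D 1)).CompatibleSplitting)
  (hGR₂ : (cmSplittingDatum (L : Type) (e₁) (frameD V) (frameD_real V) (frameD_ne V) (lineVec (L : Type) (dW' c.D 0))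
    (fun _ => dW'_real c.D 0) (fun _ => dW'_ne c.D 0)).CompatibleSplitting)
  (hGR₃ : (cmSplittingDatum (L : Type) (e₁) (frameD V) (frameD_real V) (frameD_ne V) (lineVec (L : Type) (dW' c.D 1))
    (fun _ => dW'_real c.D 1) (fun _ => dW'_ne c.D 1)).CompatibleSplitting)
  (η : CMAdelic (L : Type) (frameD V) × CMAdelic (L : Type) (dW c.D) →* ℂˣ)
  (hη : ∀ γU ∈ CMRat (L : Type) (frameD V), ∀ γ ∈ CMRat (L : Type) (dW c.D), η (γU, γ) = 1)
  (hηc : Continuous fun p => ((η p : ℂˣ) : ℂ))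
  (AG : G → ∀ k : Fin 4, ArchLineInput V (lineRepD V c.D hGR hGR₀ hGR₁ hGR₂ hGR₃ η k))

/-- (L3b) at the guarded term: `regimeEquiv … (e.symm (1, k_f)) ∈ Gfin` under the guard. -/
theorem regimeEquiv_prodSymm_one_mem_thetaAdelicSideOfP_Gfin (hc : G) (hV : IsAnisotropic L V.Hm)
    (kf : ↥(UnitaryGroup.finAdelic (↥(maximalRealSubfield L)) (L : Type) (IsCMField.complexConj L) 3 V.Hm)) :
    (Adelic.regimeEquiv L V.Hm hV ((UnitaryGroup.cmAdelicProdEquiv (L : Type) 3 V.Hm).symm (1, kf)) :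
        (V.latticeModel printFact_unitaryCompact_holds).G) ∈
      (thetaAdelicSideOfP V c G hG hGR hGR₀ hGR₁ hGR₂ hGR₃ η hη hηc AG).Gfin := by
  rw [thetaAdelicSideOfP_Gfin V c G hG hGR hGR₀ hGR₁ hGR₂ hGR₃ η hη hηc AG hc]
  exact regimeEquiv_prodSymm_one_mem_archFinOf V hV kf

/-- binder-1's **`op`** at the guarded term under the guard: period-1's `op_archSideOf`. -/
theorem op_thetaAdelicSideOfP (hc : G)
    (g : ↥(regimeSubgroup L V.Hm)) (t : SeesawTorus (↥(maximalRealSubfield L)) L)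
    (φ₁ φ₂ : piSchwartzBruhat (↥(maximalRealSubfield L)) (Fin 3)) :
    cmPairRepTwist (L : Type) finProdFinEquiv (frameD V) (frameD_real V) (frameD_ne V) (dW c.D) (dW_real c.D) (dW_ne c.D) hGR η
        ((cmFrameEquiv (L : Type) (frameG V) V.Hm (frameD V) (frame_congr V)) (g : ↥(HodgeCM.Adelic.adelicUnitaryGroup (L : Type) V.Hm)),
          cmAdelicEquiv (L : Type) 2 (Matrix.diagonal (dW c.D)) (c.D.jT₁₂ t)) (tau12 V c.D φ₁ φ₂) =
      tau12 V c.D (((thetaAdelicSideOfP V c G hG hGR hGR₀ hGR₁ hGR₂ hGR₃ η hη hηc AG).P 0).ω (g, SeesawTorus.fst _ L t) φ₁)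
        (((thetaAdelicSideOfP V c G hG hGR hGR₀ hGR₁ hGR₂ hGR₃ η hη hηc AG).P 1).ω (g, SeesawTorus.snd _ L t) φ₂) := by
  rw [thetaAdelicSideOfP_eq_archSideOf V c G hG hGR hGR₀ hGR₁ hGR₂ hGR₃ η hη hηc AG hc]
  exact op_archSideOf V c hGR hGR₀ hGR₁ hGR₂ hGR₃ η hη hηc (hG hc) (AG hc) g t φ₁ φ₂

/-- binder-1's **`seesaw`** (`SeesawHyp34`) at the guarded term under the guard: period-1's `seesaw34_archSideOf`. -/
theorem seesaw34_thetaAdelicSideOfP (hc : G)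
    (g : ↥(regimeSubgroup L V.Hm)) (t : SeesawTorus (↥(maximalRealSubfield L)) L)
    (φ₂ φ₃ : piSchwartzBruhat (↥(maximalRealSubfield L)) (Fin 3)) :
    thetaDistLM (↥(maximalRealSubfield L)) (Fin 6)
        (cmPairRepTwist (L : Type) finProdFinEquiv (frameD V) (frameD_real V) (frameD_ne V) (dW c.D) (dW_real c.D) (dW_ne c.D) hGR η
          ((cmFrameEquiv (L : Type) (frameG V) V.Hm (frameD V) (frame_congr V)) (g : ↥(HodgeCM.Adelic.adelicUnitaryGroup (L : Type) V.Hm)),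
            cmAdelicEquiv (L : Type) 2 (Matrix.diagonal (dW c.D)) (c.D.jT₃₄ t)) (tau34 V c.D φ₂ φ₃)) =
      thetaDistLM (↥(maximalRealSubfield L)) (Fin 3)
          ((((thetaAdelicSideOfP V c G hG hGR hGR₀ hGR₁ hGR₂ hGR₃ η hη hηc AG).P 2).ω (g, SeesawTorus.fst _ L t) φ₂)) *
        thetaDistLM (↥(maximalRealSubfield L)) (Fin 3)
          ((((thetaAdelicSideOfP V c G hG hGR hGR₀ hGR₁ hGR₂ hGR₃ η hη hηc AG).P 3).ω (g, SeesawTorus.snd _ L t) φ₃)) := by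
  rw [thetaAdelicSideOfP_eq_archSideOf V c G hG hGR hGR₀ hGR₁ hGR₂ hGR₃ η hη hηc AG hc]
  exact seesaw34_archSideOf V c hGR hGR₀ hGR₁ hGR₂ hGR₃ η hη hηc (hG hc) (AG hc) g t φ₂ φ₃

/-- the operator-level (34) identity at the guarded term under the guard: period-1's `op34_archSideOf`. -/
theorem op34_thetaAdelicSideOfP (hc : G)
    (g : ↥(regimeSubgroup L V.Hm)) (t : SeesawTorus (↥(maximalRealSubfield L)) L)
    (φ₂ φ₃ : piSchwartzBruhat (↥(maximalRealSubfield L)) (Fin 3)) :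
    cmPairRepTwist (L : Type) finProdFinEquiv (frameD V) (frameD_real V) (frameD_ne V) (dW c.D) (dW_real c.D) (dW_ne c.D) hGR η
        ((cmFrameEquiv (L : Type) (frameG V) V.Hm (frameD V) (frame_congr V)) (g : ↥(HodgeCM.Adelic.adelicUnitaryGroup (L : Type) V.Hm)),
          cmAdelicEquiv (L : Type) 2 (Matrix.diagonal (dW c.D)) (c.D.jT₃₄ t)) (tau34 V c.D φ₂ φ₃) =
      tau34 V c.D (((thetaAdelicSideOfP V c G hG hGR hGR₀ hGR₁ hGR₂ hGR₃ η hη hηc AG).P 2).ω (g, SeesawTorus.fst _ L t) φ₂)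
        (((thetaAdelicSideOfP V c G hG hGR hGR₀ hGR₁ hGR₂ hGR₃ η hη hηc AG).P 3).ω (g, SeesawTorus.snd _ L t) φ₃) := by
  rw [thetaAdelicSideOfP_eq_archSideOf V c G hG hGR hGR₀ hGR₁ hGR₂ hGR₃ η hη hηc AG hc]
  exact op34_archSideOf V c hGR hGR₀ hGR₁ hGR₂ hGR₃ η hη hηc (hG hc) (AG hc) g t φ₂ φ₃

end GuardedPOps

end ArchSideTerm

end HodgeCM.Model

end
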